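import Summits.QuantumFields.YangMills.Theorems.BalabanUVNodesN05AtRecord13SubBHSepCoP
import Summits.QuantumFields.YangMills.Theorems.BalabanUVNodesN05SubBHKnitUnivT8Srv

/-!
# BalabanUVNodes ∕ N05 ([B8], `Dag.B8_main`) AT THE STAGE-13 RECORD OF RECORD — PRINT'S BACKGROUND (v1.5 key `SepCo`), REPAIRED CARRIER ([B8″H] pin),
# SOCKETS AT THE `Ω₀ = ℤᵈ` LAW MEMBERS, THEOREM 8 KNIT IN AND ITS [B8]-OWN SOURCED SOCKETS SERVED: N05 in ∃-currency at `Node00.IsRecordOfRecord₁₃CSepCoPSB8subBH`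
# (+ the same-datum `₁₃CSepCo` companion) fed by `BalabanUVNodesN05SubBHKnitUnivT8Srv` — the N05 storey whose display holds TWO printed [B8] members (`p6`, `p7`)
# and otherwise [4]-type sockets at `Ω₀ = ℤᵈ` members only

Track A of `YM-PLAN.md` (cell `pub-ymgap`, HUMAN RULING D-0062), node **N05** = [Balaban1985RegularSpaces] Lemma 1, Thm 2, Prop 3, Thm 4, Props 5–7, Thm 8; seat
`pub-ymgap-dag-n05-d` (g6), 2026-08-27; director-ym LINE №152 RULING (β) + R257 co-twin row C2.  Inputs BY NAME:
`BalabanUVNodesN05SubBHKnitUnivT8Srv.b8LeafOfRecordSubBH_cutSubB_zdLan_of_knit_lettersRDUB_univ_t8srv` (this seat: the repaired slot from the `Ω₀ = ℤᵈ`-member letters ∕ b9 socket,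
the `zdLan` letters, Props. 6–7 displayed, and the two sourced b9 sockets — Prop. 5 ∃∕! with source and Prop. 3 with source PROVED inside, Theorem 8 knit in),
`BalabanUVNodesN05AtRecord13SubBHSepCoP.exists_isRecordOfRecord₁₃CSepCoPSB8subBH_b8_of_leaf` (this seat: the slot closer at the v1.5-keyed record on `Node00/Record13CarriersB8SubBHCoP`).

WHAT IS PROVED (composition BY NAME; no estimate; no new definition):
* ★ **`exists_isRecordOfRecord₁₃CSepCoPSB8subBH_b8_of_knit_lettersRDUB_univ_t8srv`** — the slot closer FED BY THE SERVED KNIT: ADMISSIBLE `θ : Stage13Params F N` WITH v1.5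
  PROVISOS `h` and the knit's inputs AT `θ.toStage3Params` (record constants; [4]'s letters `SLet ∕ SLetUB` and the b9 socket `SB9all` at the `Ω₀ = ℤᵈ` law members, [4]'s letters
  at the Prop-5 members `SLetL ∕ SLetLU`; the Prop.-5 index map `ι` with its three member laws; the printed members `p6` (at `c₁`) and `p7`; Theorem 8's constants `c59 cP3 γ₈ γ′ γ″ γβ
  B₈ B₈β`, the layer equations, the sourced guard `3·(2dL²)·B_G·B_R·(B₈ + γ₈) ≤ B₀′·B₈`, and the two SOURCED b9 sockets `SH59src` (Thm 4's frame at (1.146)) ∕ `SB9srcH` (Prop. 3's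
  frame), at `Ω₀ = ℤᵈ` members) ⇒ for every `γw ∈ ]0, θ.γ]`, `∃ w w′`: `IsRecordOfRecord₁₃CSepCoPSB8subBH F N (datumOfRecord₁₃SepCoP θ h) w` with its binding DISPLAYED at the cut
  layer `λ.cutSubB J (zdLan ∘ ι) c₁`, EVERY run's `b8` leaf and `Dag.B8_main (leavesP w P)`, and the same-datum companion `IsRecordOfRecord₁₃CSepCoP … w′` (leaves equal off `b8`).
AFTER THIS FILE the N05 face at the record of record displays TWO printed members of [Balaban1985RegularSpaces] — `p6` (Prop. 6 p. 99; its cube road awaits re-typing at print's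
`Ω₀ = T`) and `p7` (Prop. 7 p. 100; species word pending) — and otherwise [Balaban1985BackgroundPropagators]-TYPE SOCKETS at `Ω₀ = ℤᵈ` members ONLY (letters Thm 3.1; b9
Thm 3.3; b9 with source Thm 3.3 — N06 lineage ∕ J-N06→N05 junction); no displayed binder has a kernel refutation.
HONEST FRAMING: kernel bookkeeping by name; all sockets are HYPOTHESES; `p6 ∕ p7` are HYPOTHESES = N05's own printed members NOT discharged; count-neutral; **N05 NOT discharged**;
Bałaban AS PRINTED with locators; one finite 𝕋⁴ programme at fixed ε; nothing continuum ∕ ℝ⁴ ∕ OS ∕ mass-gap ∕ Clay.  No `sorry`, no new definition.  Unit `pub-ymgap-dag-n05-d`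
(g6), 2026-08-27.
[cite: Balaban1985RegularSpaces, Lemma 1 p.79, Thm 2 p.83, Prop. 3 p.87, Thm 4 p.88, Prop. 5 (1.106)–(1.110) p.94, Thm 8 (1.146) p.101 (supplied modulo [4]-type sockets); Prop. 6 (1.131)–(1.133) p.99, Prop. 7 p.100 (named hypotheses); Balaban1985BackgroundPropagators, Thm 3.1 p.397, Thm 3.3 p.398, (3.25) p.394 (letters and b9 sockets, hypotheses); Balaban1989LargeFieldII, Thm 1 + (0.1) pp.355–356; Balaban1988Convergent, p.244, (2.12)–(2.13) pp.256–257 (the record at print's background, bookkeeping)]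
-/
noncomputable section

namespace Summit.QuantumFields.YangMills.BalabanUVNodes.N05AtRecord13SubBHSepCoPT8Srv


open Literature.MathematicalPhysics.QuantumFieldTheory.Balaban1983to89
open Literature.MathematicalPhysics.QuantumFieldTheory.Balaban1983to89.Node00
open Literature.MathematicalPhysics.QuantumFieldTheory.Balaban1983to89.T4Continuum
open Literature.MathematicalPhysics.QuantumFieldTheory.Balaban1983to89.DagBinding
open Literature.MathematicalPhysics.QuantumFieldTheory.Balaban1983to89.B8IdxB8LawsB (towerBonds IdxB8LawsB IdxB8SubB famB8OfRecordSubB)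
open Literature.MathematicalPhysics.QuantumFieldTheory.Balaban1983to89.B8LeafModelZd (ZdIdx)
open Literature.MathematicalPhysics.QuantumFieldTheory.Balaban1983to89.B8LeafModelZd3 (SockB9P3)
open Literature.MathematicalPhysics.QuantumFieldTheory.Balaban1983to89.B8LeafModelZd3H (zdGF3H)
open Literature.MathematicalPhysics.QuantumFieldTheory.Balaban1983to89.B8SockLettersRD (SockLettersRD)
open Literature.MathematicalPhysics.QuantumFieldTheory.Balaban1983to89.B8Lemma1NonAbelian (mulCfg blockPairNA)
open Literature.MathematicalPhysics.QuantumFieldTheory.Balaban1983to89.B8Eq131CubesAdmissible (cubeFam)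
open Literature.MathematicalPhysics.QuantumFieldTheory.Balaban1983to89.B8CubeMemberZd (cubeLamS cubeLamB)
open Literature.MathematicalPhysics.QuantumFieldTheory.Balaban1983to89.B8Prop5LandauDataZd (ZdLanIdx zdLan)
open Summit.QuantumFields.YangMills.BalabanUVNodes.N05AtRecord13SubBHSepCoP (exists_isRecordOfRecord₁₃CSepCoPSB8subBH_b8_of_leaf)
open MatrixLog B7Prop1Explicit B7Prop2Explicit B7Prop1Local B7Eq92Concrete
open B8Ineq130 (tlo thi)
open B8Ineq132 (InAk covDerivFwd)
open B7Eq78Linearization (zdBlocking QprimeIter)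
open B8Eq119TwistedAxial (bgT Restr129 InAx)
open B8Eq140Level (SideTouches)
open B8Eq138LandauZd (covLap QT InR138 IsLandau146W)
open B8Eq1117Concrete (XSpace)
open B8Prop5ContractionKLevel (Bd2)
open B8LambdaSpaceKLevel (wt)
open B8Eq184Proof (gaugeExp cfgExp)
open B8Eq146AExpansion (iEta)
open B7Prop4GeneralLevels (linCovIter)
open B8Eq155JBound (Jcur wsup)
open B8ScaledSupNorm (bondNorm msup Bdd)
open B8Thm2LogB (blockTop)

open Literature.MathematicalPhysics.QuantumFieldTheory.Balaban1983to89.B8LanF146 (LanF146)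
open Summit.QuantumFields.YangMills.BalabanUVNodes.N05SubBHKnitUnivT8Srv (b8LeafOfRecordSubBH_cutSubB_zdLan_of_knit_lettersRDUB_univ_t8srv)
open B8Eq146AExpansion (plaqCovDeriv)
open B8Eq143PlaqExpansion (pdiv)
open B9Eq340HolderZd (hquot AdmPair)

-- `Site` alone could resolve to the torus sites of `Setup.lean`; re-export the `ℤ^d` sites of `B7Prop1Explicit`.
export B7Prop1Explicit (Site)

/-! ## ★ N05 in ∃-currency at the v1.5-keyed [B8″H] Stage-13 record, FED BY THE SERVED KNIT (printed members `p6 p7` + [4]-type sockets at `Ω₀ = ℤᵈ` members displayed) -/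

section Record

variable {F : T4Family} {N : ℕ} [NeZero N]

/-- ★ **N05 IN ∃-CURRENCY AT THE STAGE-13 RECORD OF RECORD — print's background (v1.5 key), repaired carrier, sockets at the `Ω₀ = ℤᵈ` law members, Theorem 8 knit in, its
[B8]-own sourced sockets SERVED** (one-pin S-bound record + same-datum `₁₃CSepCo` companion).  ADMISSIBLE Stage-13 parameters `θ` WITH v1.5 PROVISOS `h` and the inputs of
`BalabanUVNodesN05SubBHKnitUnivT8Srv.b8LeafOfRecordSubBH_cutSubB_zdLan_of_knit_lettersRDUB_univ_t8srv` AT `θ.toStage3Params` — record constants; [4]'s letters (`SLet`, `SLetUB`) and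
the b9 socket (`SB9all`) at the `Ω₀ = ℤᵈ` LAW members, [4]'s letters at the Prop-5 members (`SLetL`, `SLetLU`); the Prop.-5 index map `ι` with its three member laws; the printed
members `p6` (Prop. 6 p. 99, at the cut constant `c₁`) and `p7` (Prop. 7 p. 100); Theorem 8's constants, layer equations and sourced guard; the two SOURCED b9 sockets `SH59src` (at
(1.146), Thm 4's frame, threshold `c59`) and `SB9srcH` (Prop. 3's frame, threshold `cP3`) at `Ω₀ = ℤᵈ` members — give, for every window `γw ∈ ]0, θ.γ]`, worlds `w w′`:
`IsRecordOfRecord₁₃CSepCoPSB8subBH F N (datumOfRecord₁₃SepCoP θ h) w` with its binding DISPLAYED at the CUT LAYER `λ.cutSubB J (zdLan ∘ ι) c₁`, EVERY run's `b8` leaf and `Dag.B8_main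
(leavesP w P)`, and the same-datum companion `IsRecordOfRecord₁₃CSepCoP … w′` (leaves equal off `b8`; the companion's typed `b8` NOT claimed).  NOT a discharge of N05: `p6`, `p7`,
the letters families and the b9 ∕ sourced-b9 sockets are hypotheses.
[cite: Balaban1985RegularSpaces, Lemma 1 p.79, Thm 2 p.83, Prop. 3 p.87, Thm 4 p.88, Prop. 5 p.94, Thm 8 (1.146) p.101; Prop. 6 p.99, Prop. 7 p.100 (named hypotheses); Balaban1985BackgroundPropagators, Thm 3.1 p.397, Thm 3.3 p.398 (hypotheses); Balaban1989LargeFieldII, Thm 1 + (0.1) pp.355–356 (the record, bookkeeping)] -/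
theorem exists_isRecordOfRecord₁₃CSepCoPSB8subBH_b8_of_knit_lettersRDUB_univ_t8srv (θ : Stage13Params F N) (h : θ.Provisos₁₃SepCoP F N) (hθ : θ.Admissible F N)
    (lam : ResidB8 θ.toStage3Params) (hD : 2 ≤ θ.toStage3Params.D)
    (hB₁' : lam.B₁' = 5 * (θ.toStage3Params.D : ℝ) * θ.toStage3Params.L * lam.inp.B₀)
    {cB9 B₀'H B₂' BG BR cL : ℝ} (hB : 2 ≤ 5 * (θ.toStage3Params.D : ℝ) * θ.toStage3Params.L * lam.inp.B₀) (hB₀β : 0 < lam.B₀β) (hC₂ : 2097152 * ((θ.toStage3Params.D : ℝ) + 1) ^ 2 ≤ lam.C₂)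
    (hcB9 : 0 < cB9) (hB₀'H : 0 < B₀'H) (hB₂' : 0 ≤ B₂') (hBG : 0 ≤ BG) (hBR : 0 ≤ BR) (hcL : 0 < cL)
    (hfree : 3 * (2 * (θ.toStage3Params.D : ℝ) * (θ.toStage3Params.L : ℝ) ^ 2) * BG * BR ≤ lam.inp.B₀')
    -- the free-constant condition of the Prop.-5 provider (at half `B₀′`)
    (hfree2 : 3 * (2 * (θ.toStage3Params.D : ℝ) * (θ.toStage3Params.L : ℝ) ^ 2) * BG * BR ≤ lam.inp.B₀' / 2)
    -- [4]'s letters and the b9 socket AT THE `Ω₀ = ℤᵈ` LAW MEMBERS ONLY (= the sub-index of record `IdxB8SubB θ.toStage3Params`; the cube members are EXCLUDED): existence side (laws on print's domains) and uniqueness side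
    (SLet : ∀ i : ZdIdx θ.toStage3Params.D θ.toStage3Params.L, i.Ω 0 = Set.univ → IdxB8LawsB θ.toStage3Params.L i → SockLettersRD (𝔸 := θ.toStage3Params.𝔸) θ.toStage3Params.L BG BR B₀'H B₂' cL i.η i.k i.Ω i.Λs)
    (SLetUB : ∀ i : ZdIdx θ.toStage3Params.D θ.toStage3Params.L, i.Ω 0 = Set.univ → IdxB8LawsB θ.toStage3Params.L i → ∀ α₀ : ℝ, 0 < α₀ → α₀ ≤ cL → ∀ U₀ : Site θ.toStage3Params.D → Fin θ.toStage3Params.D → θ.toStage3Params.𝔸ˣ, (∀ x κ, U₀ x κ ∈ unitaryUnits θ.toStage3Params.𝔸) →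
      InAk θ.toStage3Params.L i.k i.η α₀ i.Ω U₀ →
      ∃ (g Δ : (Site θ.toStage3Params.D → θ.toStage3Params.𝔸) →ₗ[ℂ] (Site θ.toStage3Params.D → θ.toStage3Params.𝔸)) (q : (Site θ.toStage3Params.D → θ.toStage3Params.𝔸) →ₗ[ℂ] (ℕ → Site θ.toStage3Params.D → θ.toStage3Params.𝔸))
        (qs : (ℕ → Site θ.toStage3Params.D → θ.toStage3Params.𝔸) →ₗ[ℂ] (Site θ.toStage3Params.D → θ.toStage3Params.𝔸)) (Aw c : (ℕ → Site θ.toStage3Params.D → θ.toStage3Params.𝔸) →ₗ[ℂ] (ℕ → Site θ.toStage3Params.D → θ.toStage3Params.𝔸))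
        (H' : XSpace θ.toStage3Params.D i.k θ.toStage3Params.𝔸 →ₗ[ℂ] (Site θ.toStage3Params.D → θ.toStage3Params.𝔸)),
        (∀ x : Site θ.toStage3Params.D → θ.toStage3Params.𝔸, (∃ C : ℝ, ∀ y, ‖x y‖ ≤ C) → g (Δ x + qs (Aw (q x))) = x) ∧ (∀ φ, qs (c (q (g (g (qs φ))))) = qs φ) ∧
        (∀ (f : Site θ.toStage3Params.D → θ.toStage3Params.𝔸), ∀ x ∈ i.Ω 0, Δ f x = covLap i.η U₀ ((i.Ω 0).indicator f) x) ∧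
        (∀ (μ : ℕ → Site θ.toStage3Params.D → θ.toStage3Params.𝔸), ∀ x ∈ i.Ω 0, qs μ x = QT θ.toStage3Params.L i.k (i.Λs i.k) U₀ μ x) ∧
        (∀ (f : Site θ.toStage3Params.D → θ.toStage3Params.𝔸) (n : ℕ), n ≤ i.k → ∀ y ∈ i.Λs i.k n, q f n y = QprimeIter (zdBlocking θ.toStage3Params.D θ.toStage3Params.L) (bgT θ.toStage3Params.L U₀) n f y) ∧
        (∀ (f : Site θ.toStage3Params.D → θ.toStage3Params.𝔸) (n : ℕ) (y : Site θ.toStage3Params.D), ¬ (n ≤ i.k ∧ y ∈ i.Λs i.k n) → q f n y = 0) ∧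
        (∀ (X : XSpace θ.toStage3Params.D i.k θ.toStage3Params.𝔸) (x : Site θ.toStage3Params.D), ‖H' X x‖ ≤ B₀'H * ‖X‖) ∧
        (∀ n, n ≤ i.k → ∀ (X : XSpace θ.toStage3Params.D i.k θ.toStage3Params.𝔸), ∀ p ∈ {b : Site θ.toStage3Params.D × Fin θ.toStage3Params.D | SideTouches (i.Ω n) b.1 b.2},
          wt θ.toStage3Params.L i.η n * ‖covDerivFwd i.η U₀ p.2 (H' X) p.1‖ ≤ B₀'H * ‖X‖) ∧
        (∀ X : XSpace θ.toStage3Params.D i.k θ.toStage3Params.𝔸, Bd2 θ.toStage3Params.L i.η i.k i.Ω (covLap i.η U₀ (H' X)) (B₂' * ‖X‖)) ∧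
        (∀ (Y : XSpace θ.toStage3Params.D i.k θ.toStage3Params.𝔸) (n : ℕ) (hn : n ≤ i.k) (y : Site θ.toStage3Params.D), y ∈ i.Λs i.k n →
          QprimeIter (zdBlocking θ.toStage3Params.D θ.toStage3Params.L) (bgT θ.toStage3Params.L U₀) n (H' Y) y = Y (⟨n, Nat.lt_succ_of_le hn⟩, y)) ∧
        (∀ (f : Site θ.toStage3Params.D → θ.toStage3Params.𝔸) (r : ℝ), 0 ≤ r → Bd2 θ.toStage3Params.L i.η i.k i.Ω f r →
          (∀ x, ‖g f x‖ ≤ BG * r) ∧ ∀ n, n ≤ i.k → ∀ p ∈ {b : Site θ.toStage3Params.D × Fin θ.toStage3Params.D | SideTouches (i.Ω n) b.1 b.2},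
            wt θ.toStage3Params.L i.η n * ‖covDerivFwd i.η U₀ p.2 (g f) p.1‖ ≤ BG * r) ∧
        (∀ (f : Site θ.toStage3Params.D → θ.toStage3Params.𝔸) (r : ℝ), 0 ≤ r → Bd2 θ.toStage3Params.L i.η i.k i.Ω f r → Bd2 θ.toStage3Params.L i.η i.k i.Ω (f - g (qs (c (q (g f))))) (BR * r)))
    (SB9all : ∀ i : ZdIdx θ.toStage3Params.D θ.toStage3Params.L, i.Ω 0 = Set.univ → IdxB8LawsB θ.toStage3Params.L i → ∀ m, m ≤ i.k →
      SockB9P3 (𝔸 := θ.toStage3Params.𝔸) θ.toStage3Params.L lam.inp.B₀ lam.B₀β cB9 lam.β lam.len i.η m i.Ω i.Λs i.Λb)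
    -- PROPOSITION 5's INDEX READ AS OBJECTS: `zdLan` members obeying the member laws, with [4]'s letters at each (RD currency)
    {J : Type} (ι : J → ZdLanIdx θ.toStage3Params.D θ.toStage3Params.𝔸)
    (hΩ0L : ∀ a : J, (ι a).Ω 0 = Set.univ) (hΩL : ∀ a : J, ∀ j, (ι a).Ω (j + 1) ⊆ (ι a).Ω j)
    (htowerL : ∀ a : J, ∀ j, j ≤ (ι a).k → ∀ y ∈ (ι a).Λ j, ∀ x, InBox (tlo θ.toStage3Params.L y j) (thi θ.toStage3Params.L y j) x → x ∈ (ι a).Ω j)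
    (SLetL : ∀ a : J, ∀ α₀ : ℝ, 0 < α₀ → α₀ ≤ cL → InAk θ.toStage3Params.L (ι a).k (ι a).η α₀ (ι a).Ω (ι a).U₀ →
      ∃ (g Δ : (Site θ.toStage3Params.D → θ.toStage3Params.𝔸) →ₗ[ℂ] (Site θ.toStage3Params.D → θ.toStage3Params.𝔸)) (q : (Site θ.toStage3Params.D → θ.toStage3Params.𝔸) →ₗ[ℂ] (ℕ → Site θ.toStage3Params.D → θ.toStage3Params.𝔸))
        (qs : (ℕ → Site θ.toStage3Params.D → θ.toStage3Params.𝔸) →ₗ[ℂ] (Site θ.toStage3Params.D → θ.toStage3Params.𝔸)) (Aw c : (ℕ → Site θ.toStage3Params.D → θ.toStage3Params.𝔸) →ₗ[ℂ] (ℕ → Site θ.toStage3Params.D → θ.toStage3Params.𝔸))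
        (H' : XSpace θ.toStage3Params.D (ι a).k θ.toStage3Params.𝔸 →ₗ[ℂ] (Site θ.toStage3Params.D → θ.toStage3Params.𝔸)),
        (∀ x, ∀ y ∈ (ι a).Ω 0, (Δ (g x) + qs (Aw (q (g x)))) y = x y) ∧ (∀ f, q (g (g (qs (c (q f))))) = q f) ∧
        (∀ (f : Site θ.toStage3Params.D → θ.toStage3Params.𝔸), ∀ x ∈ (ι a).Ω 0, Δ f x = covLap (ι a).η (ι a).U₀ (((ι a).Ω 0).indicator f) x) ∧
        (∀ (μ : ℕ → Site θ.toStage3Params.D → θ.toStage3Params.𝔸), ∀ x ∈ (ι a).Ω 0, qs μ x = QT θ.toStage3Params.L (ι a).k (ι a).Λ (ι a).U₀ μ x) ∧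
        (∀ (f : Site θ.toStage3Params.D → θ.toStage3Params.𝔸) (j : ℕ), j ≤ (ι a).k → ∀ y ∈ (ι a).Λ j, q f j y = QprimeIter (zdBlocking θ.toStage3Params.D θ.toStage3Params.L) (bgT θ.toStage3Params.L (ι a).U₀) j f y) ∧
        (∀ (X : XSpace θ.toStage3Params.D (ι a).k θ.toStage3Params.𝔸) (x : Site θ.toStage3Params.D), ‖H' X x‖ ≤ B₀'H * ‖X‖) ∧
        (∀ j, j ≤ (ι a).k → ∀ (X : XSpace θ.toStage3Params.D (ι a).k θ.toStage3Params.𝔸), ∀ p ∈ {b : Site θ.toStage3Params.D × Fin θ.toStage3Params.D | SideTouches ((ι a).Ω j) b.1 b.2},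
          wt θ.toStage3Params.L (ι a).η j * ‖covDerivFwd (ι a).η (ι a).U₀ p.2 (H' X) p.1‖ ≤ B₀'H * ‖X‖) ∧
        (∀ X : XSpace θ.toStage3Params.D (ι a).k θ.toStage3Params.𝔸, Bd2 θ.toStage3Params.L (ι a).η (ι a).k (ι a).Ω (covLap (ι a).η (ι a).U₀ (H' X)) (B₂' * ‖X‖)) ∧
        (∀ (X : XSpace θ.toStage3Params.D (ι a).k θ.toStage3Params.𝔸) (x : Site θ.toStage3Params.D), x ∉ (ι a).Ω 0 → H' X x = 0) ∧
        (∀ X Y : XSpace θ.toStage3Params.D (ι a).k θ.toStage3Params.𝔸, (∀ p, Y p = -star (X p)) → ∀ x, H' Y x = -star (H' X x)) ∧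
        (∀ (Y : XSpace θ.toStage3Params.D (ι a).k θ.toStage3Params.𝔸) (j : ℕ) (hj : j ≤ (ι a).k) (y : Site θ.toStage3Params.D), y ∈ (ι a).Λ j →
          QprimeIter (zdBlocking θ.toStage3Params.D θ.toStage3Params.L) (bgT θ.toStage3Params.L (ι a).U₀) j (H' Y) y = Y (⟨j, Nat.lt_succ_of_le hj⟩, y)) ∧
        (∀ (f : Site θ.toStage3Params.D → θ.toStage3Params.𝔸) (r : ℝ), 0 ≤ r → Bd2 θ.toStage3Params.L (ι a).η (ι a).k (ι a).Ω f r →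
          (∀ x, ‖g f x‖ ≤ BG * r) ∧ ∀ j, j ≤ (ι a).k → ∀ p ∈ {b : Site θ.toStage3Params.D × Fin θ.toStage3Params.D | SideTouches ((ι a).Ω j) b.1 b.2},
            wt θ.toStage3Params.L (ι a).η j * ‖covDerivFwd (ι a).η (ι a).U₀ p.2 (g f) p.1‖ ≤ BG * r) ∧
        (∀ (f : Site θ.toStage3Params.D → θ.toStage3Params.𝔸) (x : Site θ.toStage3Params.D), x ∉ (ι a).Ω 0 → g f x = 0) ∧
        (∀ f : Site θ.toStage3Params.D → θ.toStage3Params.𝔸, (∀ j, j ≤ (ι a).k → ∀ x ∈ (ι a).Ω j, IsSelfAdjoint (f x)) → ∀ x, IsSelfAdjoint (g f x)) ∧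
        (∀ (f : Site θ.toStage3Params.D → θ.toStage3Params.𝔸) (r : ℝ), 0 ≤ r → Bd2 θ.toStage3Params.L (ι a).η (ι a).k (ι a).Ω f r →
          Bd2 θ.toStage3Params.L (ι a).η (ι a).k (ι a).Ω (f - g (qs (c (q (g f))))) (BR * r)) ∧
        (∀ f : Site θ.toStage3Params.D → θ.toStage3Params.𝔸, (∀ j, j ≤ (ι a).k → ∀ x ∈ (ι a).Ω j, IsSelfAdjoint (f x)) →
          ∀ j, j ≤ (ι a).k → ∀ x ∈ (ι a).Ω j, IsSelfAdjoint ((f - g (qs (c (q (g f))))) x)))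
    -- [4]'s UNIQUENESS letters at the Prop-5 members (left-inverse law of G′ on bounded functions), for Prop. 5's uniqueness clause there
    (SLetLU : ∀ a : J, ∀ α₀ : ℝ, 0 < α₀ → α₀ ≤ cL → InAk θ.toStage3Params.L (ι a).k (ι a).η α₀ (ι a).Ω (ι a).U₀ →
      ∃ (g Δ : (Site θ.toStage3Params.D → θ.toStage3Params.𝔸) →ₗ[ℂ] (Site θ.toStage3Params.D → θ.toStage3Params.𝔸)) (q : (Site θ.toStage3Params.D → θ.toStage3Params.𝔸) →ₗ[ℂ] (ℕ → Site θ.toStage3Params.D → θ.toStage3Params.𝔸)) (qs : (ℕ → Site θ.toStage3Params.D → θ.toStage3Params.𝔸) →ₗ[ℂ] (Site θ.toStage3Params.D → θ.toStage3Params.𝔸))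
        (Aw c : (ℕ → Site θ.toStage3Params.D → θ.toStage3Params.𝔸) →ₗ[ℂ] (ℕ → Site θ.toStage3Params.D → θ.toStage3Params.𝔸)) (H' : XSpace θ.toStage3Params.D (ι a).k θ.toStage3Params.𝔸 →ₗ[ℂ] (Site θ.toStage3Params.D → θ.toStage3Params.𝔸)),
        (∀ x : Site θ.toStage3Params.D → θ.toStage3Params.𝔸, (∃ C : ℝ, ∀ y, ‖x y‖ ≤ C) → g (Δ x + qs (Aw (q x))) = x) ∧ (∀ φ, qs (c (q (g (g (qs φ))))) = qs φ) ∧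
        (∀ (f : Site θ.toStage3Params.D → θ.toStage3Params.𝔸), ∀ x ∈ (ι a).Ω 0, Δ f x = covLap (ι a).η (ι a).U₀ (((ι a).Ω 0).indicator f) x) ∧
        (∀ (μ : ℕ → Site θ.toStage3Params.D → θ.toStage3Params.𝔸), ∀ x ∈ (ι a).Ω 0, qs μ x = QT θ.toStage3Params.L (ι a).k (ι a).Λ (ι a).U₀ μ x) ∧
        (∀ (f : Site θ.toStage3Params.D → θ.toStage3Params.𝔸) (n : ℕ), n ≤ (ι a).k → ∀ y ∈ (ι a).Λ n, q f n y = QprimeIter (zdBlocking θ.toStage3Params.D θ.toStage3Params.L) (bgT θ.toStage3Params.L (ι a).U₀) n f y) ∧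
        (∀ (f : Site θ.toStage3Params.D → θ.toStage3Params.𝔸) (n : ℕ) (y : Site θ.toStage3Params.D), ¬ (n ≤ (ι a).k ∧ y ∈ (ι a).Λ n) → q f n y = 0) ∧
        (∀ (X : XSpace θ.toStage3Params.D (ι a).k θ.toStage3Params.𝔸) (x : Site θ.toStage3Params.D), ‖H' X x‖ ≤ B₀'H * ‖X‖) ∧
        (∀ n, n ≤ (ι a).k → ∀ (X : XSpace θ.toStage3Params.D (ι a).k θ.toStage3Params.𝔸), ∀ p ∈ {b : Site θ.toStage3Params.D × Fin θ.toStage3Params.D | SideTouches ((ι a).Ω n) b.1 b.2},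
          wt θ.toStage3Params.L (ι a).η n * ‖covDerivFwd (ι a).η (ι a).U₀ p.2 (H' X) p.1‖ ≤ B₀'H * ‖X‖) ∧
        (∀ X : XSpace θ.toStage3Params.D (ι a).k θ.toStage3Params.𝔸, Bd2 θ.toStage3Params.L (ι a).η (ι a).k (ι a).Ω (covLap (ι a).η (ι a).U₀ (H' X)) (B₂' * ‖X‖)) ∧
        (∀ (Y : XSpace θ.toStage3Params.D (ι a).k θ.toStage3Params.𝔸) (n : ℕ) (hn : n ≤ (ι a).k) (y : Site θ.toStage3Params.D), y ∈ (ι a).Λ n →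
          QprimeIter (zdBlocking θ.toStage3Params.D θ.toStage3Params.L) (bgT θ.toStage3Params.L (ι a).U₀) n (H' Y) y = Y (⟨n, Nat.lt_succ_of_le hn⟩, y)) ∧
        (∀ (f : Site θ.toStage3Params.D → θ.toStage3Params.𝔸) (r : ℝ), 0 ≤ r → Bd2 θ.toStage3Params.L (ι a).η (ι a).k (ι a).Ω f r →
          (∀ x, ‖g f x‖ ≤ BG * r) ∧ ∀ n, n ≤ (ι a).k → ∀ p ∈ {b : Site θ.toStage3Params.D × Fin θ.toStage3Params.D | SideTouches ((ι a).Ω n) b.1 b.2},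
            wt θ.toStage3Params.L (ι a).η n * ‖covDerivFwd (ι a).η (ι a).U₀ p.2 (g f) p.1‖ ≤ BG * r) ∧
        (∀ (f : Site θ.toStage3Params.D → θ.toStage3Params.𝔸) (r : ℝ), 0 ≤ r → Bd2 θ.toStage3Params.L (ι a).η (ι a).k (ι a).Ω f r →
          Bd2 θ.toStage3Params.L (ι a).η (ι a).k (ι a).Ω (f - g (qs (c (q (g f))))) (BR * r)))
    -- PROPOSITION 6 (displayed), PROPOSITION 7 and THEOREM 8 SURVIVING AT THE REPAIRED MEMBERS (hypotheses)
    -- PROPOSITION 6 on the record's cube family at the cut constant `c₁` (DISPLAYED: its cube-socket road `SLetC`∕`SB9C` is certified unsatisfiable, p508450)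
    (c₁ : ℝ) (p6 : B8.Prop6Printed θ.toStage3Params.D (θ.toStage3Params.L : ℝ) lam.B₁ c₁ (fun j : IdxB8SubB θ.toStage3Params => cubB8OfRecord θ.toStage3Params j.1))
    (p7 : B8SectGH.Prop7PrintedR (fun j : IdxB8SubB θ.toStage3Params => famB8OfRecordSubB θ.toStage3Params lam.β lam.len j) (fun j => lam.toAxial j.1))
    -- THEOREM 8's INPUTS AT THE LAW MEMBERS: constants (print p. 101 «only some constants change»), the layer equations, the sourced free-constant
    -- guard of the Proposition-5 providers, and the TWO remaining SOURCED sockets — [Balaban1985BackgroundPropagators] Thm 3.3 WITH SOURCE in Theorem 4's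
    -- frame at the gauge condition (1.146) (`SH59src`, threshold `c59`) and in Proposition 3's frame (`SB9srcH`, threshold `cP3`) — each demanded ONLY at
    -- members `i` with `Ω₀ = ℤᵈ` obeying the four laws; Proposition 5 ∃∕! with source and Proposition 3 with source are SUPPLIED inside from them
    {c59 cP3 γ₈ γ' γ'' γβ B₈ B₈β : ℝ} (hc59 : 0 < c59) (hcP3 : 0 < cP3) (hγ₈ : 1 ≤ γ₈) (hγ' : 0 ≤ γ') (hγ'' : 0 ≤ γ'') (hB₀8 : lam.inp.B₀ ≤ B₈)
    (hγB : 5 * (θ.toStage3Params.D : ℝ) * θ.toStage3Params.L * lam.inp.B₀ + 2 * (γ' * lam.inp.B₀) ≤ 5 * (θ.toStage3Params.D : ℝ) * θ.toStage3Params.L * B₈)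
    (hγB'' : 5 * (θ.toStage3Params.D : ℝ) * θ.toStage3Params.L * lam.inp.B₀ + 2 * (γ'' * lam.inp.B₀) ≤ 5 * (θ.toStage3Params.D : ℝ) * θ.toStage3Params.L * B₈)
    (hB8β : 5 * (θ.toStage3Params.D : ℝ) * θ.toStage3Params.L * lam.B₀β + 2 * lam.B₀β * (γ'' * lam.inp.B₀) + γβ ≤ 5 * (θ.toStage3Params.D : ℝ) * θ.toStage3Params.L * B₈β)
    (hB₁eq : lam.B₁ = 5 * (θ.toStage3Params.D : ℝ) * θ.toStage3Params.L * B₈ * (1 + 11 * (θ.toStage3Params.D : ℝ) ^ 2)) (hB₂eq : lam.B₂ = 5 * (θ.toStage3Params.D : ℝ) * θ.toStage3Params.L * B₈β * (1 + 11 * (θ.toStage3Params.D : ℝ) ^ 2))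
    (hfreeS : 3 * (2 * (θ.toStage3Params.D : ℝ) * (θ.toStage3Params.L : ℝ) ^ 2) * BG * BR * (B₈ + γ₈) ≤ lam.inp.B₀' * B₈)
    (SH59src : ∀ i : ZdIdx θ.toStage3Params.D θ.toStage3Params.L, i.Ω 0 = Set.univ → IdxB8LawsB θ.toStage3Params.L i → ∀ α₀ α₁ : ℝ, 0 < α₀ → 0 < α₁ → α₀ + α₁ ≤ c59 →
      ∀ U₀ U' : Site θ.toStage3Params.D → Fin θ.toStage3Params.D → θ.toStage3Params.𝔸ˣ, (∀ x κ, U₀ x κ ∈ unitaryUnits θ.toStage3Params.𝔸) → (∀ x κ, U' x κ ∈ unitaryUnits θ.toStage3Params.𝔸) →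
      ∀ φ : Site θ.toStage3Params.D → θ.toStage3Params.𝔸, ((InR138 θ.toStage3Params.L i.k i.η (i.Ω 0) (i.Λs i.k) U₀ φ ∧ (∀ x, IsSelfAdjoint (φ x)) ∧ (∀ x, x ∉ i.Ω 0 → φ x = 0) ∧
          Bdd θ.toStage3Params.L i.k i.η (-(2 : ℝ)) (fun j (x : Site θ.toStage3Params.D) => x ∈ i.Ω j) φ) ∧
        msup θ.toStage3Params.L i.k i.η (-(2 : ℝ)) (fun j (x : Site θ.toStage3Params.D) => x ∈ i.Ω j) φ < γ₈ * (α₀ + α₁)) →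
      InAk θ.toStage3Params.L i.k i.η α₀ i.Ω U₀ → InAk θ.toStage3Params.L i.k i.η α₀ i.Ω (mulCfg U' U₀) → (∀ m, m ≤ i.k → InAx θ.toStage3Params.L m (i.Λs m) U₀ (mulCfg U' U₀)) →
      (∀ j, j ≤ i.k → ∀ (z : Site θ.toStage3Params.D) (μ : Fin θ.toStage3Params.D), (∀ x, InBox (loK θ.toStage3Params.L j z) (bondHiK θ.toStage3Params.L j z μ) x → x ∈ i.Ω j) →
        ‖(avgIter θ.toStage3Params.L (mulCfg U' U₀) j z μ : θ.toStage3Params.𝔸) - (avgIter θ.toStage3Params.L U₀ j z μ : θ.toStage3Params.𝔸)‖ ≤ α₁) →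
      (∀ b ∈ {b : Site θ.toStage3Params.D × Fin θ.toStage3Params.D | SideTouches (i.Ω 0) b.1 b.2}, ‖((U' b.1 b.2 : θ.toStage3Params.𝔸ˣ) : θ.toStage3Params.𝔸) - 1‖ ≤ α₁) →
      (∀ m, 1 ≤ m → m ≤ i.k → ∀ (u : Site θ.toStage3Params.D → θ.toStage3Params.𝔸ˣ) (W : Site θ.toStage3Params.D → Fin θ.toStage3Params.D → θ.toStage3Params.𝔸ˣ) (A' : Site θ.toStage3Params.D → Fin θ.toStage3Params.D → θ.toStage3Params.𝔸),
        (∀ x, u x ∈ unitaryUnits θ.toStage3Params.𝔸) → mgauge U₀ u W = U' → Restr129 θ.toStage3Params.L m (i.Λs m) U₀ u → LanF146 θ.toStage3Params.L i.k i.η (i.Ω 0) i.Λs U₀ φ m W →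
        (∀ y τ, IsSelfAdjoint (A' y τ)) →
        (∀ j, j ≤ m → ∀ y τ, SideTouches (i.Ω j) y τ →
        W y τ = cfgExp i.η A' y τ ∧ ‖A' y τ‖ ≤ (2 * (θ.toStage3Params.L * (5 * (θ.toStage3Params.D : ℝ) * θ.toStage3Params.L * B₈ * (α₀ + α₁))) + 8 * (8 * lam.inp.B₀' * (5 * (θ.toStage3Params.D : ℝ) * θ.toStage3Params.L * B₈) * (α₀ + α₁))) * ((θ.toStage3Params.L : ℝ) ^ j * i.η)⁻¹) →
        (∀ y τ, (∀ j, j ≤ m → ¬ SideTouches (i.Ω j) y τ) → A' y τ = 0) →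
        msup θ.toStage3Params.L m i.η (-(1 : ℝ)) (fun j (b : Site θ.toStage3Params.D × Fin θ.toStage3Params.D) => SideTouches (i.Ω j) b.1 b.2) (fun b => A' b.1 b.2)
        ≤ lam.inp.B₀ * (bondNorm θ.toStage3Params.L m i.η (-(3 : ℝ)) i.Ω (fun x μ => Jcur i.η U₀ A' μ x)
        + wsup 1 (fun p : {p : ℕ × (Site θ.toStage3Params.D × Fin θ.toStage3Params.D) // p.1 ≤ m ∧ p.2 ∈ i.Λb m p.1} =>
        linCovIter θ.toStage3Params.L U₀ (iEta i.η A') p.1.1 p.1.2.1 p.1.2.2)) + γ' * lam.inp.B₀ * (α₀ + α₁) ∧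
        msup θ.toStage3Params.L m i.η (-(2 : ℝ)) (fun j (t : Fin θ.toStage3Params.D × Fin θ.toStage3Params.D × Site θ.toStage3Params.D) => SideTouches (i.Ω j) t.2.2 t.2.1)
        (fun t => covDerivFwd i.η U₀ t.1 (fun z => A' z t.2.1) t.2.2)
        ≤ lam.inp.B₀ * (bondNorm θ.toStage3Params.L m i.η (-(3 : ℝ)) i.Ω (fun x μ => Jcur i.η U₀ A' μ x)
        + wsup 1 (fun p : {p : ℕ × (Site θ.toStage3Params.D × Fin θ.toStage3Params.D) // p.1 ≤ m ∧ p.2 ∈ i.Λb m p.1} =>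
        linCovIter θ.toStage3Params.L U₀ (iEta i.η A') p.1.1 p.1.2.1 p.1.2.2)) + γ' * lam.inp.B₀ * (α₀ + α₁)))
    (SB9srcH : ∀ i : ZdIdx θ.toStage3Params.D θ.toStage3Params.L, i.Ω 0 = Set.univ → IdxB8LawsB θ.toStage3Params.L i → ∀ α₀ α₁ α₂ : ℝ, 0 < α₀ → α₀ ≤ cP3 → 0 < α₁ → 0 < α₂ → α₂ ≤ cP3 →
      ∀ (U₀ W : Site θ.toStage3Params.D → Fin θ.toStage3Params.D → θ.toStage3Params.𝔸ˣ), (∀ x κ, U₀ x κ ∈ unitaryUnits θ.toStage3Params.𝔸) → (∀ x κ, W x κ ∈ unitaryUnits θ.toStage3Params.𝔸) →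
      ∀ f : Site θ.toStage3Params.D → θ.toStage3Params.𝔸, InR138 θ.toStage3Params.L i.k i.η (i.Ω 0) (i.Λs i.k) U₀ f →
      (∀ x, IsSelfAdjoint (f x)) → (∀ x, x ∉ i.Ω 0 → f x = 0) →
      Bdd θ.toStage3Params.L i.k i.η (-(2 : ℝ)) (fun j (x : Site θ.toStage3Params.D) => x ∈ i.Ω j) f →
      msup θ.toStage3Params.L i.k i.η (-(2 : ℝ)) (fun j (x : Site θ.toStage3Params.D) => x ∈ i.Ω j) f < γ₈ * (α₀ + α₁) →
      msup θ.toStage3Params.L i.k i.η (-(3 : ℝ)) (fun j (p : Fin θ.toStage3Params.D × Site θ.toStage3Params.D) => p.2 ∈ i.Ω j) (fun p => covDerivFwd i.η U₀ p.1 f p.2) < γ₈ * (α₀ + α₁) →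
      InAk θ.toStage3Params.L i.k i.η α₀ i.Ω U₀ → InAk θ.toStage3Params.L i.k i.η α₀ i.Ω (mulCfg W U₀) → IsLandau146W θ.toStage3Params.L i.k i.η (i.Ω 0) (i.Λs i.k) U₀ f W →
      ∀ A' : Site θ.toStage3Params.D → Fin θ.toStage3Params.D → θ.toStage3Params.𝔸, (∀ y τ, IsSelfAdjoint (A' y τ)) →
      (∀ j, j ≤ i.k → ∀ (y : Site θ.toStage3Params.D) (τ : Fin θ.toStage3Params.D), SideTouches (i.Ω j) y τ →
        W y τ = cfgExp i.η A' y τ ∧ ‖A' y τ‖ ≤ α₂ * ((θ.toStage3Params.L : ℝ) ^ j * i.η)⁻¹) →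
      (∀ (y : Site θ.toStage3Params.D) (τ : Fin θ.toStage3Params.D), (∀ j, j ≤ i.k → ¬ SideTouches (i.Ω j) y τ) → A' y τ = 0) →
      msup θ.toStage3Params.L i.k i.η (-(1 : ℝ)) (fun j (b : Site θ.toStage3Params.D × Fin θ.toStage3Params.D) => SideTouches (i.Ω j) b.1 b.2) (fun b => A' b.1 b.2)
          ≤ lam.inp.B₀ * (bondNorm θ.toStage3Params.L i.k i.η (-(3 : ℝ)) i.Ω (fun x μ => Jcur i.η U₀ A' μ x)
            + wsup 1 (fun p : {p : ℕ × (Site θ.toStage3Params.D × Fin θ.toStage3Params.D) // p.1 ≤ i.k ∧ p.2 ∈ i.Λb i.k p.1} =>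
                linCovIter θ.toStage3Params.L U₀ (iEta i.η A') p.1.1 p.1.2.1 p.1.2.2)) + γ'' * lam.inp.B₀ * (α₀ + α₁) ∧
        msup θ.toStage3Params.L i.k i.η (-(2 : ℝ)) (fun j (t : Fin θ.toStage3Params.D × Fin θ.toStage3Params.D × Site θ.toStage3Params.D) => SideTouches (i.Ω j) t.2.2 t.2.1)
            (fun t => covDerivFwd i.η U₀ t.1 (fun z => A' z t.2.1) t.2.2)
          ≤ lam.inp.B₀ * (bondNorm θ.toStage3Params.L i.k i.η (-(3 : ℝ)) i.Ω (fun x μ => Jcur i.η U₀ A' μ x)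
            + wsup 1 (fun p : {p : ℕ × (Site θ.toStage3Params.D × Fin θ.toStage3Params.D) // p.1 ≤ i.k ∧ p.2 ∈ i.Λb i.k p.1} =>
                linCovIter θ.toStage3Params.L U₀ (iEta i.η A') p.1.1 p.1.2.1 p.1.2.2)) + γ'' * lam.inp.B₀ * (α₀ + α₁) ∧
        bondNorm θ.toStage3Params.L i.k i.η (-(3 : ℝ)) i.Ω (fun x μ => pdiv i.η U₀ (plaqCovDeriv i.η U₀ A') μ x)
          ≤ lam.inp.B₀ * (bondNorm θ.toStage3Params.L i.k i.η (-(3 : ℝ)) i.Ω (fun x μ => Jcur i.η U₀ A' μ x)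
            + wsup 1 (fun p : {p : ℕ × (Site θ.toStage3Params.D × Fin θ.toStage3Params.D) // p.1 ≤ i.k ∧ p.2 ∈ i.Λb i.k p.1} =>
                linCovIter θ.toStage3Params.L U₀ (iEta i.η A') p.1.1 p.1.2.1 p.1.2.2)) + γ'' * lam.inp.B₀ * (α₀ + α₁) ∧
        bondNorm θ.toStage3Params.L i.k i.η (-(3 : ℝ)) i.Ω (fun x μ => covLap i.η U₀ (fun z => A' z μ) x)
          ≤ lam.inp.B₀ * (bondNorm θ.toStage3Params.L i.k i.η (-(3 : ℝ)) i.Ω (fun x μ => Jcur i.η U₀ A' μ x)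
            + wsup 1 (fun p : {p : ℕ × (Site θ.toStage3Params.D × Fin θ.toStage3Params.D) // p.1 ≤ i.k ∧ p.2 ∈ i.Λb i.k p.1} =>
                linCovIter θ.toStage3Params.L U₀ (iEta i.η A') p.1.1 p.1.2.1 p.1.2.2)) + γ'' * lam.inp.B₀ * (α₀ + α₁) ∧
        msup θ.toStage3Params.L i.k i.η (-(2 + lam.β)) (fun j (q : Fin θ.toStage3Params.D × Fin θ.toStage3Params.D × (Site θ.toStage3Params.D × Site θ.toStage3Params.D)) => q.2.2 ∈ AdmPair i.η lam.len ∧ q.2.2.1 ∈ i.Ω j)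
            (fun q => hquot i.η lam.β lam.len U₀ (covDerivFwd i.η U₀ q.1 (fun z => A' z q.2.1)) q.2.2)
          ≤ lam.B₀β * (bondNorm θ.toStage3Params.L i.k i.η (-(3 : ℝ)) i.Ω (fun x μ => Jcur i.η U₀ A' μ x)
            + wsup 1 (fun p : {p : ℕ × (Site θ.toStage3Params.D × Fin θ.toStage3Params.D) // p.1 ≤ i.k ∧ p.2 ∈ i.Λb i.k p.1} =>
                linCovIter θ.toStage3Params.L U₀ (iEta i.η A') p.1.1 p.1.2.1 p.1.2.2)) + γβ * (α₀ + α₁))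
    {γw : ℝ} (hγ0 : 0 < γw) (hγ1 : γw ≤ θ.γ) :
    ∃ w w' : WorldP, IsRecordOfRecord₁₃CSepCoPSB8subBH F N (datumOfRecord₁₃SepCoP F N θ h) w ∧
      w.C = (datumOfRecord₁₃SepCoP F N θ h).C ∧ w.γ = γw ∧ w.L = (θ.L : ℝ) ∧
      (∀ P : B12.RunParams, w.up P =
        upOfRecord₅CS F N ((θ.pinB8SubBH F N (lam.cutSubB J (fun a : J => zdLan θ.toStage3Params.L lam.B₁ (ι a)) c₁)).toStage5₁₃CoP F N) P) ∧
      (∀ P : B12.RunParams, (leavesP w P).b8 ∧ Dag.B8_main (leavesP w P)) ∧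
      IsRecordOfRecord₁₃CSepCoP F N (datumOfRecord₁₃SepCoP F N θ h) w' ∧ w'.C = w.C ∧ w'.γ = w.γ ∧ w'.L = w.L ∧
      ∀ P : B12.RunParams, leavesP w P = { leavesP w' P with b8 := (leavesP w P).b8 } :=
  exists_isRecordOfRecord₁₃CSepCoPSB8subBH_b8_of_leaf θ h hθ _
    (b8LeafOfRecordSubBH_cutSubB_zdLan_of_knit_lettersRDUB_univ_t8srv lam hD hB₁' hB hB₀β hC₂ hcB9 hB₀'H hB₂' hBG hBR hcL hfree hfree2 SLet SLetUB SB9all ι hΩ0L hΩL htowerL SLetL SLetLU c₁ p6 p7 hc59 hcP3 hγ₈ hγ' hγ'' hB₀8 hγB hγB'' hB8β hB₁eq hB₂eq hfreeS SH59src SB9srcH) hγ0 hγ1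

end Record

#print axioms exists_isRecordOfRecord₁₃CSepCoPSB8subBH_b8_of_knit_lettersRDUB_univ_t8srv

end Summit.QuantumFields.YangMills.BalabanUVNodes.N05AtRecord13SubBHSepCoPT8Srv

end
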